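import Summits.HodgeConjecture.HodgeConjecture.Theses.LinearSystemTorelli
import Literature.AlgebraicGeometry.HodgeTheory.InvariantClassesFromTotalSpace
import Literature.AlgebraicGeometry.HodgeTheory.InvariantClassesFromTotalSpaceHolds
import Literature.AlgebraicGeometry.Motives.MixedHodgeStructureOfPair
import HarnessLib

/-!
# Route `LinearSystemTorelli` — crux `DeligneGlobalInvariantCycles` (stmt-HodgeConjecture-16363)
# modulo ONE ∃-package: Deligne's mixed Hodge structures with Hodge II, Cor. 3.2.17

The route item `LinearSystemTorelli.DeligneGlobalInvariantCycles` (Deligne's théorème de la partie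
fixe, Hodge II Thm. 4.1.1, pointwise on the tree's carriers; verbatim the body of the Literature fact
`deligne_globalInvariantCycles`) is the conjunction of two published inputs (Voisin II §4.3.3):
Thm. 4.18 (Deligne 1968: the invariant classes come from the OPEN total space) and Prop. 4.23 (the
open total space and a smooth compactification have the same image in the cohomology of a fibre;
weights and strictness). The first is a THEOREM of the tree
(`deligne1968_invariantClass_fromTotalSpace_holds`, file `InvariantClassesFromTotalSpaceHolds`); the
second is proved in the tree (`GlobalInvariantCyclesProofs`, `GlobalInvariantCyclesCoefficientsProofs`:
strictness `Hom.map_W_eq`, purity of the fibre, the `ℚ → ℂ` passage) from a package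
`M : Motives.MixedHodgeStructureOfPair ℂ` of Deligne's mixed Hodge structures (named fact
`existsDeligne`) together with Hodge II, Cor. 3.2.17 for `M` (`W_k Hᵏ(𝒳; ℚ) ⊆ Im i^*` for an open
immersion `i : 𝒳 ⟶ 𝒳̄` into a smooth projective `𝒳̄`). Hence the item is closed MODULO that one
∃-statement — recorded here on the route decl by name, so that a discharge of the package closes the
item in one line (`deligneGlobalInvariantCycles_of_mixedHodgePackage`).

## Main results

* `deligneGlobalInvariantCycles_of_mixedHodgePackage` — (∃ `M` with Cor. 3.2.17) → the item
  (`deligneGlobalInvariantCycles_of_fact`, item ⟸ fact, is `Theorems.deligneGlobalInvariantCycles_of_fact`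
  of `BoundaryReadoutAbsoluteReductionOfFacts.lean` and is not restated).

CONDITIONAL (the gate records a `conditional-result`; the item stays open until Hodge II–III's mixed
Hodge structures with Cor. 3.2.17 are formalised).

## References

* P. Deligne, *Théorie de Hodge II*, Publ. Math. IHÉS 40 (1971), Thm. 4.1.1, Cor. 3.2.17,
  Thm. 2.3.5. [DeligneHodgeII1971]
* C. Voisin, *Hodge Theory and Complex Algebraic Geometry II* (CUP 2003), Thm. 4.18, Prop. 4.23,
  Thm. 4.24. [VoisinHodgeII2003]
* P. Deligne, *Théorème de Lefschetz et critères de dégénérescence de suites spectrales*, Publ. Math.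
  IHÉS 35 (1968), Thm. 1.5, Prop. 2.1. [Deligne1968]
-/

-- every declaration of this problem lives in `Summit.HodgeConjecture.HodgeConjecture.…`
-- (single-problem summit: Problem = Summit), which `linter.dupNamespace` flags; set so that
-- stand-alone elaboration is warning-free.
set_option linter.dupNamespace false

noncomputable section

namespace Summit.HodgeConjecture.HodgeConjecture.Theorems

open CategoryTheory AlgebraicGeometry
open Literature.AlgebraicGeometry Literature.AlgebraicGeometry.Motives
open Literature.AlgebraicGeometry.HodgeTheory
open Summit.HodgeConjecture.HodgeConjecture.Theses

/-- **The partie fixe (route item stmt-HodgeConjecture-16363) modulo Deligne's mixed Hodge structures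
with Hodge II, Cor. 3.2.17.** If there is a package `M : Motives.MixedHodgeStructureOfPair ℂ` of mixed
Hodge structures on the rational cohomology of pairs of complex varieties (functorial, pure on smooth
projective varieties, Hodge numbers in the box — the named fact `existsDeligne`) which moreover
satisfies Cor. 3.2.17 (`W_k Hᵏ(𝒳; ℚ) ⊆ Im(i^* : Hᵏ(𝒳̄; ℚ) → Hᵏ(𝒳; ℚ))` for every open immersion
`i : 𝒳 ⟶ 𝒳̄` into a smooth projective `𝒳̄`), then `LinearSystemTorelli.DeligneGlobalInvariantCycles`
holds: the Deligne-1968 half is the tree theorem `deligne1968_invariantClass_fromTotalSpace_holds`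
and the assembly (Prop. 4.23 by strictness and purity, `ℚ → ℂ`) is
`deligne_globalInvariantCycles_of_deligne1968_of_cor3217`. CONDITIONAL on the package.
[cite: DeligneHodgeII1971, Théorème 4.1.1 and Cor. 3.2.17] [cite: VoisinHodgeII2003, Thm. 4.18, Prop. 4.23, Thm. 4.24] -/
theorem deligneGlobalInvariantCycles_of_mixedHodgePackage
    (hM : ∃ M : MixedHodgeStructureOfPair ℂ,
      ∀ (𝒳 Xbar : SchemeOver ℂ) (i : 𝒳 ⟶ Xbar) (m : ℕ),
        IsProjectiveOver Xbar → SmoothOfRelativeDimension m Xbar.hom → IsOpenImmersion i.left →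
        ∀ k : ℕ, (M.mhs (SchemePair.ofScheme 𝒳) k).W k ≤
          LinearMap.range (SchemePair.bettiCohomology.map (SchemePair.Hom.ofScheme i) k).hom) :
    LinearSystemTorelli.DeligneGlobalInvariantCycles := by
  obtain ⟨M, h3217⟩ := hM
  exact deligne_globalInvariantCycles_of_deligne1968_of_cor3217
    deligne1968_invariantClass_fromTotalSpace_holds M h3217

end Summit.HodgeConjecture.HodgeConjecture.Theorems

end
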